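/-
Copyright (c) 2026 the pub-hodgecm-mathlib formalisation cell (harness21).  Prover seat hodgecm-mathlib-K2E1-p12 (g2), Track B ∕ K2-LIT, h413 = `stmt-HodgeConjecture-24833`,
line `K2_E1_TraceFormulaBeta`, (225) FILE α of the dealer K2E1-plan (g7): the GENERIC-`ρ₀` edition of ★ p860128 `K2E1MaassSelbergDiagonalRealAxisCMThree` (K2E4-p14 (g9)) — the
real-variable analysis that pays the Maass–Selberg letters (MS-P) at REAL points and (MS-ρ₀) at the pole `z₀ = ρ₀` for the diagonal four-term with exponent shift `2ρ_H = ρ₀`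
(`ρ₀ = 2`: `U(2,1)`, ★ p860128's instance; `ρ₀ = 1`: `U(1,1)`, the (MS-real)₂ chain).  No automorphic objects in this file.
-/
import Summits.HodgeConjecture.HodgeConjecture.Theorems.K2E1MaassSelbergDiagonalRealAxisCMThree   -- ★ p860128 (K2E4-p14 g9): the ρ₀-free lemmas §1∕§2∕§4 REUSED BY NAME (`exists_abs_im_le_mul_abs_im`, `norm_cpow_neg_sub_conj`, `contDiff_cpow_neg_sub_conj`, `norm_conj_sub_self_div`, `exists_abs_im_div_le`, `eventually_norm_le_of_im_ne_zero`)
import HarnessLib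

/-!
# K2·E1 — `K2E1MaassSelbergDiagonalRealAxis`: the diagonal Maass–Selberg four-term `R_{ρ₀}(z, z; c̃)` with exponent shift `ρ₀` is bounded near EVERY point of `{ρ₀ < 2·Re}` off `ρ₀`,
# and `|z − ρ₀|²·R_{ρ₀}` is bounded near the pole `ρ₀` — GENERIC `ρ₀` (real), instances `ρ₀ = 2` (★ p860128, `U(2,1)`) and `ρ₀ = 1` (`U(1,1)`)

Track B ∕ K2-LIT, crux h413 = `stmt-HodgeConjecture-24833`, route of record `HCCMUnconditional`; cell `hodgecm-mathlib`, squad K2, ENGINE E1.  Prover seat `hodgecm-mathlib-K2E1-p12` (g2);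
deal (225) of the dealer K2E1-plan (g7) («FILE α = the GENERIC-ρ₀ edition (`ρ₀ : ℂ`, `ρ₀.im = 0`, half-plane `ρ₀.re < 2·re z₀`; instances ρ₀ = 2 ∕ ρ₀ = 1)»; K2E4-p14 (g9)'s (216)
request «keep FILE 1 GENERIC in the scalar∕exponent data … say in the docstring which binder carries N»).  THE BINDER THAT CARRIES `N` IS `ρ₀ = 2ρ_H` (`= N − 1` for the quasi-split
`U(J_N)`, `N ∈ {2, 3}`): it is the exponent shift of the outer terms `T^{±(z+z̄−ρ₀)}∕(z+z̄−ρ₀)` AND the location of the simple pole of the scalar `c̃`.  THEOREMS ONLY (no `def`, no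
`instance`, no notation, no named-fact hypothesis, no `sorry`); lane `--supports stmt-HodgeConjecture-24833 --as helper` (count-neutral).  Closes no socket.  The ρ₀-free lemmas of ★
p860128 (§1 `exists_abs_im_le_mul_abs_im`, §2 `norm_cpow_neg_sub_conj` ∕ `contDiff_cpow_neg_sub_conj` ∕ `norm_conj_sub_self_div`, §3 `exists_abs_im_div_le`, §4
`eventually_norm_le_of_im_ne_zero`) are REUSED BY NAME, not restated; only the four ρ₀-dependent statements are re-proved with `2 ↦ ρ₀` (proofs verbatim).

THE MATHEMATICS [MoeglinWaldspurger1995, IV.2.3, IV.3.12 (a); Arthur1980TraceFormulaII, §4].  On the diagonal the continued Maass–Selberg relation of a rank-one truncated Eisenstein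
family reads `‖Λ^T Ẽ(z)‖² = R_{ρ₀}(z, z; c̃(z))` with the four-term
`R_{ρ₀} = Cμ·CK·( T^{z+z̄−ρ₀}∕(z+z̄−ρ₀)·κm|φ₀|² + T^{z−z̄}∕(z−z̄)·κm φ₀·conj(c̃ z φ₀) − T^{−(z−z̄)}∕(z−z̄)·κm c̃ z φ₀ conj φ₀ − T^{−(z+z̄−ρ₀)}∕(z+z̄−ρ₀)·κm c̃ z φ₀ conj(c̃ z φ₀) )`
(★ `normSq_family_eq_fourTerm_on'` at `N = 3`, `ρ₀ = 2`; ★ `poleControl_continued_cm_two_of_pairing_on'` currency at `N = 2`, `ρ₀ = 1`).  The two middle summands carry `1∕|Im z|`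
but COMBINE: `R_{ρ₀} = Cμ CK κ m |φ₀|² · ( T^{2x−ρ₀}∕(2x−ρ₀) + (conj k − k)∕(z − z̄) − T^{−(2x−ρ₀)}∕(2x−ρ₀)·|c̃ z|² )`, `k(z) := T^{−(z−z̄)}·c̃(z)` (§1, exact), and
`‖(conj k − k)∕(z − z̄)‖ = |Im k(z)|∕|Im z|` is bounded near a real point when `c̃` is REAL ON THE REAL AXIS (★ p860128 §1: `C¹ ⇒` Lipschitz).  Hence `R_{ρ₀}(z, z; c̃)` is BOUNDED near
every `z₀` with `ρ₀ < 2·Re z₀` at which `c̃` is analytic (§2), and `|z − ρ₀|²·R_{ρ₀}` is bounded near `z₀ = ρ₀` (`ρ₀ > 0`) where `c̃` has its simple pole (`(z−ρ₀)c̃ = d` analytic at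
`ρ₀`, `k₂ := conj(z−ρ₀)·T^{−(z−z̄)}·d` real on the real axis).
* §1 **`fourTerm_diag_eq`** (the exact recombination, shift `ρ₀`), `norm_fourTerm_diag_le`, `exists_norm_outer_le` (`ρ₀ < 2·Re z₀`).
* §2 HEADS **`exists_norm_fourTerm_diag_le`** (near `z₀`, `ρ₀.re < 2·z₀.re`, `c̃` analytic at `z₀`, real on the real trace if `z₀` is real) and
  **`exists_normSq_mul_norm_fourTerm_diag_le`** (the `|z−ρ₀|²`-weighted bound at the pole `ρ₀`, `0 < ρ₀.re`, `ρ₀.im = 0`).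
CONSUMERS: FILE β `K2E1SphericalEisensteinL2BoundCMTwo` (ρ₀ = 1; this seat, (225)), K2E4-p14 (g9)'s FILE 2–4 at ρ₀ = 2, the sd-χ editions D4′c (SD).
HONEST LABEL: HC_CM is proved only modulo the 7 printed citations (2 remaining named inputs: hLiu418 = `stmt-HodgeConjecture-24832`, h413 = `stmt-HodgeConjecture-24833`) until rung 0
closes; this file asserts no named fact and closes no socket; count-neutral; unconditional.

## References
* [MoeglinWaldspurger1995] C. Mœglin, J.-L. Waldspurger, *Spectral decomposition and Eisenstein series* (1995), IV.2.3, IV.3.12 (a).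
* [Arthur1980TraceFormulaII] J. Arthur, *A trace formula for reductive groups II*, Compositio Math. 40 (1980), §4.
-/

set_option autoImplicit false
-- the mandated namespace repeats the single-problem summit's segment (`HodgeConjecture.HodgeConjecture`)
set_option linter.dupNamespace false

noncomputable section

open Set Filter Topology Metric Complex
open scoped ComplexConjugate
open Literature.NumberTheory.EllipticCurves.ModularForms (conj_ofReal_cpow)
open Summit.HodgeConjecture.HodgeConjecture.Cruxes.H413.K2E1MaassSelbergDiagonalRealAxisCMThree
  (exists_abs_im_le_mul_abs_im norm_cpow_neg_sub_conj contDiff_cpow_neg_sub_conj norm_conj_sub_self_div exists_abs_im_div_le eventually_norm_le_of_im_ne_zero)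

namespace Summit.HodgeConjecture.HodgeConjecture.Cruxes.H413.K2E1MaassSelbergDiagonalRealAxis

/-! ## §1 The recombined diagonal four-term with exponent shift `ρ₀` -/

/-- **THE EXACT RECOMBINATION OF THE DIAGONAL FOUR-TERM** (shift `ρ₀`): with `k := T^{−(z−z̄)}·c`,
`R_{ρ₀}(z, z; c) = Cμ·CK·κ·m·φ₀·conj φ₀ · ( T^{z+z̄−ρ₀}∕(z+z̄−ρ₀) + (conj k − k)∕(z − z̄) − T^{−(z+z̄−ρ₀)}∕(z+z̄−ρ₀)·c·conj c )` — the two `1∕(z − z̄)` summands combined.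
[cite: MoeglinWaldspurger1995, IV.2.3] -/
theorem fourTerm_diag_eq (Cμ CK κ m : ℝ) {T : ℝ} (hT : 0 < T) (φ₀ : ℂ) (ρ₀ c z : ℂ) :
    ((Cμ : ℝ) : ℂ) * (((CK : ℝ) : ℂ) *
        ((((T : ℝ) : ℂ) ^ (z + conj z - ρ₀) / (z + conj z - ρ₀)) * (((κ : ℝ) : ℂ) * (((m : ℝ) : ℂ) * (φ₀ * conj φ₀)))
          + (((T : ℝ) : ℂ) ^ (z - conj z) / (z - conj z)) * (((κ : ℝ) : ℂ) * (((m : ℝ) : ℂ) * (φ₀ * conj (c * φ₀))))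
          - (((T : ℝ) : ℂ) ^ (-(z - conj z)) / (z - conj z)) * (((κ : ℝ) : ℂ) * (((m : ℝ) : ℂ) * (c * φ₀ * conj φ₀)))
          - (((T : ℝ) : ℂ) ^ (-(z + conj z - ρ₀)) / (z + conj z - ρ₀)) * (((κ : ℝ) : ℂ) * (((m : ℝ) : ℂ) * (c * φ₀ * conj (c * φ₀)))))) =
      (((Cμ : ℝ) : ℂ) * (((CK : ℝ) : ℂ) * (((κ : ℝ) : ℂ) * (((m : ℝ) : ℂ) * (φ₀ * conj φ₀))))) *
        (((T : ℝ) : ℂ) ^ (z + conj z - ρ₀) / (z + conj z - ρ₀)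
          + (conj (((T : ℝ) : ℂ) ^ (-(z - conj z)) * c) - ((T : ℝ) : ℂ) ^ (-(z - conj z)) * c) / (z - conj z)
          - ((T : ℝ) : ℂ) ^ (-(z + conj z - ρ₀)) / (z + conj z - ρ₀) * (c * conj c)) := by
  have hc1 : conj (((T : ℝ) : ℂ) ^ (-(z - conj z)) * c) = ((T : ℝ) : ℂ) ^ (z - conj z) * conj c := by
    rw [map_mul, conj_ofReal_cpow hT.le, map_neg, map_sub, conj_conj, neg_sub]
  rw [hc1, map_mul]
  simp only [div_eq_mul_inv]
  ring

/-- **THE NORM OF THE DIAGONAL FOUR-TERM** (shift `ρ₀`), off the real axis: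
`‖R_{ρ₀}(z, z; c)‖ ≤ ‖Cμ CK κ m φ₀ conj φ₀‖·( ‖T^{z+z̄−ρ₀}∕(z+z̄−ρ₀)‖ + |Im k z|∕|Im z| + ‖T^{−(z+z̄−ρ₀)}∕(z+z̄−ρ₀)‖·‖c‖² )`, `k z = T^{−(z−z̄)}·c`. [cite: MoeglinWaldspurger1995, IV.2.3] -/
theorem norm_fourTerm_diag_le (Cμ CK κ m : ℝ) {T : ℝ} (hT : 0 < T) (φ₀ : ℂ) (ρ₀ c z : ℂ) :
    ‖((Cμ : ℝ) : ℂ) * (((CK : ℝ) : ℂ) *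
        ((((T : ℝ) : ℂ) ^ (z + conj z - ρ₀) / (z + conj z - ρ₀)) * (((κ : ℝ) : ℂ) * (((m : ℝ) : ℂ) * (φ₀ * conj φ₀)))
          + (((T : ℝ) : ℂ) ^ (z - conj z) / (z - conj z)) * (((κ : ℝ) : ℂ) * (((m : ℝ) : ℂ) * (φ₀ * conj (c * φ₀))))
          - (((T : ℝ) : ℂ) ^ (-(z - conj z)) / (z - conj z)) * (((κ : ℝ) : ℂ) * (((m : ℝ) : ℂ) * (c * φ₀ * conj φ₀)))
          - (((T : ℝ) : ℂ) ^ (-(z + conj z - ρ₀)) / (z + conj z - ρ₀)) * (((κ : ℝ) : ℂ) * (((m : ℝ) : ℂ) * (c * φ₀ * conj (c * φ₀))))))‖ ≤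
      ‖((Cμ : ℝ) : ℂ) * (((CK : ℝ) : ℂ) * (((κ : ℝ) : ℂ) * (((m : ℝ) : ℂ) * (φ₀ * conj φ₀))))‖ *
        (‖((T : ℝ) : ℂ) ^ (z + conj z - ρ₀) / (z + conj z - ρ₀)‖ + |(((T : ℝ) : ℂ) ^ (-(z - conj z)) * c).im| / |z.im|
          + ‖((T : ℝ) : ℂ) ^ (-(z + conj z - ρ₀)) / (z + conj z - ρ₀)‖ * ‖c‖ ^ 2) := by
  rw [fourTerm_diag_eq Cμ CK κ m hT φ₀ ρ₀ c z, norm_mul]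
  refine mul_le_mul_of_nonneg_left ?_ (norm_nonneg _)
  refine (norm_sub_le _ _).trans (add_le_add ((norm_add_le _ _).trans (add_le_add le_rfl ?_)) ?_)
  · rw [norm_conj_sub_self_div]
  · rw [norm_mul, norm_mul, RCLike.norm_conj, sq]

/-- The two outer coefficients `T^{±(z+z̄−ρ₀)}∕(z+z̄−ρ₀)` are bounded near every `z₀` with `ρ₀ < 2·Re z₀` (`ρ₀` real; continuity on `{ρ₀ < 2·Re}`, where
`Re (z + z̄ − ρ₀) = 2·Re z − ρ₀ ≠ 0`). [folklore] -/
theorem exists_norm_outer_le {T : ℝ} (hT : 0 < T) {ρ₀ z₀ : ℂ} (hz₀ : ρ₀.re < 2 * z₀.re) :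
    ∃ B : ℝ, ∀ᶠ z in 𝓝 z₀, ‖((T : ℝ) : ℂ) ^ (z + conj z - ρ₀) / (z + conj z - ρ₀)‖ ≤ B ∧ ‖((T : ℝ) : ℂ) ^ (-(z + conj z - ρ₀)) / (z + conj z - ρ₀)‖ ≤ B := by
  set S : Set ℂ := {z : ℂ | ρ₀.re < 2 * z.re} with hSdef
  have hSo : IsOpen S := isOpen_lt continuous_const (continuous_const.mul continuous_re)
  have hT0 : ((T : ℝ) : ℂ) ≠ 0 := ofReal_ne_zero.2 hT.ne'
  have hne : ∀ z ∈ S, z + conj z - ρ₀ ≠ 0 := fun z hz h => by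
    have := congrArg Complex.re h
    simp only [sub_re, add_re, conj_re, zero_re] at this
    have hz' : ρ₀.re < 2 * z.re := hz
    linarith
  have hd : ContinuousOn (fun z : ℂ => z + conj z - ρ₀) S := ((continuous_id.add continuous_conj).sub continuous_const).continuousOn
  have e₁ : ContinuousOn (fun z : ℂ => ((T : ℝ) : ℂ) ^ (z + conj z - ρ₀) / (z + conj z - ρ₀)) S := (hd.const_cpow (Or.inl hT0)).div hd hne
  have e₄ : ContinuousOn (fun z : ℂ => ((T : ℝ) : ℂ) ^ (-(z + conj z - ρ₀)) / (z + conj z - ρ₀)) S := (hd.neg.const_cpow (Or.inl hT0)).div hd hne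
  obtain ⟨r, hr0, hrS⟩ := Metric.nhds_basis_closedBall.mem_iff.1 (hSo.mem_nhds (show z₀ ∈ S from hz₀))
  obtain ⟨B₁, hB₁⟩ := (isCompact_closedBall z₀ r).exists_bound_of_continuousOn (e₁.mono hrS)
  obtain ⟨B₄, hB₄⟩ := (isCompact_closedBall z₀ r).exists_bound_of_continuousOn (e₄.mono hrS)
  refine ⟨max B₁ B₄, ?_⟩
  filter_upwards [Metric.closedBall_mem_nhds z₀ hr0] with z hz
  exact ⟨(hB₁ z hz).trans (le_max_left _ _), (hB₄ z hz).trans (le_max_right _ _)⟩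

/-! ## §2 The two bounds: near any `z₀` with `ρ₀ < 2·Re z₀` where `c̃` is analytic, and the weighted bound at the pole `ρ₀` -/

/-- **THE DIAGONAL FOUR-TERM (SHIFT `ρ₀`) IS BOUNDED NEAR EVERY `z₀` WITH `ρ₀ < 2·Re z₀` AT WHICH `c̃` IS ANALYTIC** — off the real axis near `z₀`; if `z₀` is real, `c̃` is asked to be
real at the real points `x ≠ Re z₀` near it (reflection principle).  The `1∕|Im z|` of the two middle summands cancels (§1 + ★ p860128 §1).  `ρ₀ = 2`: ★ p860128's head verbatim.
[cite: MoeglinWaldspurger1995, IV.2.3, IV.3.12 (a)] [cite: Arthur1980TraceFormulaII, §4] -/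
theorem exists_norm_fourTerm_diag_le (Cμ CK κ m : ℝ) {T : ℝ} (hT : 0 < T) (φ₀ : ℂ) {ρ₀ : ℂ} {c : ℂ → ℂ} {z₀ : ℂ} (hz₀ : ρ₀.re < 2 * z₀.re)
    (hc : AnalyticAt ℂ c z₀) (hreal : z₀.im = 0 → ∀ᶠ x : ℝ in 𝓝[≠] z₀.re, (c (x : ℂ)).im = 0) :
    ∃ C : ℝ, ∀ᶠ z in 𝓝 z₀, z.im ≠ 0 →
      ‖((Cμ : ℝ) : ℂ) * (((CK : ℝ) : ℂ) *
        ((((T : ℝ) : ℂ) ^ (z + conj z - ρ₀) / (z + conj z - ρ₀)) * (((κ : ℝ) : ℂ) * (((m : ℝ) : ℂ) * (φ₀ * conj φ₀)))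
          + (((T : ℝ) : ℂ) ^ (z - conj z) / (z - conj z)) * (((κ : ℝ) : ℂ) * (((m : ℝ) : ℂ) * (φ₀ * conj (c z * φ₀))))
          - (((T : ℝ) : ℂ) ^ (-(z - conj z)) / (z - conj z)) * (((κ : ℝ) : ℂ) * (((m : ℝ) : ℂ) * (c z * φ₀ * conj φ₀)))
          - (((T : ℝ) : ℂ) ^ (-(z + conj z - ρ₀)) / (z + conj z - ρ₀)) * (((κ : ℝ) : ℂ) * (((m : ℝ) : ℂ) * (c z * φ₀ * conj (c z * φ₀))))))‖ ≤ C := by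
  obtain ⟨B, hB⟩ := exists_norm_outer_le hT hz₀
  obtain ⟨C₁, hC₁⟩ := exists_abs_im_div_le hT (hc.contDiffAt.restrict_scalars ℝ) hreal
  obtain ⟨M, hM⟩ : ∃ M : ℝ, ∀ᶠ z in 𝓝 z₀, ‖c z‖ ≤ M :=
    ⟨‖c z₀‖ + 1, (hc.continuousAt.norm.eventually (Iic_mem_nhds (lt_add_one ‖c z₀‖))).mono fun z hz => hz⟩
  set K₀ : ℝ := ‖((Cμ : ℝ) : ℂ) * (((CK : ℝ) : ℂ) * (((κ : ℝ) : ℂ) * (((m : ℝ) : ℂ) * (φ₀ * conj φ₀))))‖ with hK₀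
  refine ⟨K₀ * (B + C₁ + B * M ^ 2), ?_⟩
  filter_upwards [hB, hC₁, hM] with z hzB hzC hzM hzim
  refine (norm_fourTerm_diag_le Cμ CK κ m hT φ₀ ρ₀ (c z) z).trans (mul_le_mul_of_nonneg_left ?_ (norm_nonneg _))
  have hB0 : 0 ≤ B := (norm_nonneg _).trans hzB.1
  exact add_le_add (add_le_add hzB.1 (hzC hzim)) (mul_le_mul hzB.2 (pow_le_pow_left₀ (norm_nonneg _) hzM 2) (sq_nonneg _) hB0)

/-- **THE `|z − ρ₀|²`-WEIGHTED DIAGONAL FOUR-TERM IS BOUNDED NEAR THE POLE `z₀ = ρ₀`** (`ρ₀` real, `0 < ρ₀`; off the real axis), where `c̃` has a simple pole: `(z − ρ₀)·c̃ = d` near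
`ρ₀` with `d` analytic at `ρ₀`, and `c̃` real at the real points `x ≠ ρ₀` near `ρ₀`.  With `k₂ := conj(z−ρ₀)·T^{−(z−z̄)}·d` (real on the real axis, `C¹`): `|z−ρ₀|²·|Im k| = |Im k₂| ≤ C|Im z|`;
the outer terms carry `|z−ρ₀|² ≤ 1` and `|(z−ρ₀)c̃|² = |d|²`.  This is the scalar heart of (MS-ρ₀): `ρ₀ = 2` for `U(2,1)` (★ p860128), `ρ₀ = 1` for `U(1,1)`.
[cite: MoeglinWaldspurger1995, IV.2.3, IV.3.12 (a)] [cite: Arthur1980TraceFormulaII, §4] -/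
theorem exists_normSq_mul_norm_fourTerm_diag_le (Cμ CK κ m : ℝ) {T : ℝ} (hT : 0 < T) (φ₀ : ℂ) {ρ₀ : ℂ} (hρ₀ : ρ₀.im = 0) (hρ₀pos : 0 < ρ₀.re) {c d : ℂ → ℂ}
    (hd : AnalyticAt ℂ d ρ₀) (hdc : ∀ᶠ z in 𝓝[≠] ρ₀, d z = (z - ρ₀) * c z) (hreal : ∀ᶠ x : ℝ in 𝓝[≠] ρ₀.re, (c (x : ℂ)).im = 0) :
    ∃ C : ℝ, ∀ᶠ z in 𝓝[≠] ρ₀, z.im ≠ 0 →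
      ‖z - ρ₀‖ ^ 2 * ‖((Cμ : ℝ) : ℂ) * (((CK : ℝ) : ℂ) *
        ((((T : ℝ) : ℂ) ^ (z + conj z - ρ₀) / (z + conj z - ρ₀)) * (((κ : ℝ) : ℂ) * (((m : ℝ) : ℂ) * (φ₀ * conj φ₀)))
          + (((T : ℝ) : ℂ) ^ (z - conj z) / (z - conj z)) * (((κ : ℝ) : ℂ) * (((m : ℝ) : ℂ) * (φ₀ * conj (c z * φ₀))))
          - (((T : ℝ) : ℂ) ^ (-(z - conj z)) / (z - conj z)) * (((κ : ℝ) : ℂ) * (((m : ℝ) : ℂ) * (c z * φ₀ * conj φ₀)))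
          - (((T : ℝ) : ℂ) ^ (-(z + conj z - ρ₀)) / (z + conj z - ρ₀)) * (((κ : ℝ) : ℂ) * (((m : ℝ) : ℂ) * (c z * φ₀ * conj (c z * φ₀))))))‖ ≤ C := by
  -- `ρ₀` is real
  have hρ₀eq : ((ρ₀.re : ℝ) : ℂ) = ρ₀ := Complex.ext (by simp) (by simp [hρ₀])
  have hρ₀conj : conj ρ₀ = ρ₀ := conj_eq_iff_im.2 hρ₀
  -- the outer coefficients near `ρ₀`, `d` bounded near `ρ₀`
  obtain ⟨B, hB⟩ := exists_norm_outer_le hT (show ρ₀.re < 2 * ρ₀.re by linarith)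
  obtain ⟨M, hM⟩ : ∃ M : ℝ, ∀ᶠ z in 𝓝 ρ₀, ‖d z‖ ≤ M :=
    ⟨‖d ρ₀‖ + 1, (hd.continuousAt.norm.eventually (Iic_mem_nhds (lt_add_one ‖d ρ₀‖))).mono fun z hz => hz⟩
  -- `k₂ := conj(z−ρ₀)·T^{−(z−z̄)}·d` is `C¹` at `ρ₀` and real on the punctured real trace
  have hk₂ : ContDiffAt ℝ 1 (fun z : ℂ => conj (z - ρ₀) * (((T : ℝ) : ℂ) ^ (-(z - conj z)) * d z)) ((ρ₀.re : ℝ) : ℂ) := by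
    have hconj : ContDiff ℝ 1 (fun z : ℂ => conj z) := by
      have : (fun z : ℂ => conj z) = ⇑conjCLE := funext fun z => (conjCLE_apply z).symm
      rw [this]; exact conjCLE.contDiff
    rw [hρ₀eq]
    exact (hconj.comp (contDiff_id.sub contDiff_const)).contDiffAt.mul (((contDiff_cpow_neg_sub_conj hT).contDiffAt).mul (hd.contDiffAt.restrict_scalars ℝ))
  have hdc' : ∀ᶠ x : ℝ in 𝓝[≠] ρ₀.re, d (x : ℂ) = ((x : ℂ) - ρ₀) * c (x : ℂ) := by
    have ht : Tendsto (fun x : ℝ => (x : ℂ)) (𝓝[≠] ρ₀.re) (𝓝[≠] ρ₀) := by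
      refine tendsto_nhdsWithin_of_tendsto_nhds_of_eventually_within _ ((continuous_ofReal.tendsto' ρ₀.re ρ₀ hρ₀eq).mono_left nhdsWithin_le_nhds) ?_
      filter_upwards [self_mem_nhdsWithin] with x hx
      simp only [mem_compl_iff, mem_singleton_iff] at hx ⊢
      intro h
      exact hx (by rw [← ofReal_re x, h])
    exact ht.eventually hdc
  have hk₂real : ∀ᶠ x : ℝ in 𝓝[≠] ρ₀.re, ((fun z : ℂ => conj (z - ρ₀) * (((T : ℝ) : ℂ) ^ (-(z - conj z)) * d z)) (x : ℂ)).im = 0 := by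
    filter_upwards [hreal, hdc'] with x hx hxd
    simp only [hxd, conj_ofReal, sub_self, neg_zero, cpow_zero, one_mul, map_sub, hρ₀conj, mul_im, sub_re, sub_im, ofReal_re, ofReal_im, hρ₀, hx]
    ring
  obtain ⟨C₁, hC₁⟩ := exists_abs_im_le_mul_abs_im hk₂ hk₂real
  rw [hρ₀eq] at hC₁
  set K₀ : ℝ := ‖((Cμ : ℝ) : ℂ) * (((CK : ℝ) : ℂ) * (((κ : ℝ) : ℂ) * (((m : ℝ) : ℂ) * (φ₀ * conj φ₀))))‖ with hK₀
  refine ⟨K₀ * (B + C₁ + B * M ^ 2), ?_⟩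
  have hball : ∀ᶠ z in 𝓝[≠] ρ₀, ‖z - ρ₀‖ ≤ 1 := by
    filter_upwards [mem_nhdsWithin_of_mem_nhds (Metric.closedBall_mem_nhds ρ₀ one_pos)] with z hz
    rwa [Metric.mem_closedBall, dist_eq_norm] at hz
  filter_upwards [mem_nhdsWithin_of_mem_nhds hB, mem_nhdsWithin_of_mem_nhds hC₁, mem_nhdsWithin_of_mem_nhds hM, hdc, hball] with z hzB hzC hzM hzd hz1 hzim
  have hB0 : 0 ≤ B := (norm_nonneg _).trans hzB.1
  have hsq : ‖z - ρ₀‖ ^ 2 ≤ 1 := by nlinarith [norm_nonneg (z - ρ₀)]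
  -- `|z−ρ₀|²·|Im k| = |Im k₂|`
  have hk₂eq : (((‖z - ρ₀‖ ^ 2 : ℝ)) : ℂ) * (((T : ℝ) : ℂ) ^ (-(z - conj z)) * c z) = conj (z - ρ₀) * (((T : ℝ) : ℂ) ^ (-(z - conj z)) * d z) := by
    rw [hzd, ofReal_pow, ← conj_mul' (z - ρ₀)]; ring
  have hmid : ‖z - ρ₀‖ ^ 2 * (|(((T : ℝ) : ℂ) ^ (-(z - conj z)) * c z).im| / |z.im|) ≤ C₁ := by
    rw [← mul_div_assoc, div_le_iff₀ (abs_pos.2 hzim), ← abs_of_nonneg (sq_nonneg ‖z - ρ₀‖), ← abs_mul, ← im_ofReal_mul, hk₂eq]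
    exact hzC
  calc ‖z - ρ₀‖ ^ 2 * _ ≤ ‖z - ρ₀‖ ^ 2 * (K₀ * (‖((T : ℝ) : ℂ) ^ (z + conj z - ρ₀) / (z + conj z - ρ₀)‖ + |(((T : ℝ) : ℂ) ^ (-(z - conj z)) * c z).im| / |z.im|
          + ‖((T : ℝ) : ℂ) ^ (-(z + conj z - ρ₀)) / (z + conj z - ρ₀)‖ * ‖c z‖ ^ 2)) :=
        mul_le_mul_of_nonneg_left (norm_fourTerm_diag_le Cμ CK κ m hT φ₀ ρ₀ (c z) z) (sq_nonneg _)
    _ = K₀ * (‖z - ρ₀‖ ^ 2 * ‖((T : ℝ) : ℂ) ^ (z + conj z - ρ₀) / (z + conj z - ρ₀)‖ + ‖z - ρ₀‖ ^ 2 * (|(((T : ℝ) : ℂ) ^ (-(z - conj z)) * c z).im| / |z.im|)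
          + ‖((T : ℝ) : ℂ) ^ (-(z + conj z - ρ₀)) / (z + conj z - ρ₀)‖ * (‖z - ρ₀‖ * ‖c z‖) ^ 2) := by ring
    _ ≤ K₀ * (B + C₁ + B * M ^ 2) := by
        refine mul_le_mul_of_nonneg_left (add_le_add (add_le_add ?_ hmid) ?_) (norm_nonneg _)
        · exact (mul_le_mul hsq hzB.1 (norm_nonneg _) zero_le_one).trans_eq (one_mul B)
        · refine mul_le_mul hzB.2 (pow_le_pow_left₀ (by positivity) ?_ 2) (sq_nonneg _) hB0
          rw [← norm_mul, ← hzd]; exact hzM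

/-! ## §3 The two instances of record, by `rfl`-specialisation: `ρ₀ = 1` (`U(1,1)`) -/

/-- **(MS-1)'s scalar heart for `U(1,1)`**: the `ρ₀ = 1` instance of `exists_normSq_mul_norm_fourTerm_diag_le` (pole `1`, shift `z + z̄ − 1`), in the `N = 2` four-term currency of ★
`poleControl_continued_cm_two_of_pairing_on'`. [cite: MoeglinWaldspurger1995, IV.2.3, IV.3.12 (a)] -/
theorem exists_normSq_mul_norm_fourTerm_diag_le_one (Cμ CK κ m : ℝ) {T : ℝ} (hT : 0 < T) (φ₀ : ℂ) {c d : ℂ → ℂ}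
    (hd : AnalyticAt ℂ d 1) (hdc : ∀ᶠ z in 𝓝[≠] (1 : ℂ), d z = (z - 1) * c z) (hreal : ∀ᶠ x : ℝ in 𝓝[≠] (1 : ℝ), (c (x : ℂ)).im = 0) :
    ∃ C : ℝ, ∀ᶠ z in 𝓝[≠] (1 : ℂ), z.im ≠ 0 →
      ‖z - 1‖ ^ 2 * ‖((Cμ : ℝ) : ℂ) * (((CK : ℝ) : ℂ) *
        ((((T : ℝ) : ℂ) ^ (z + conj z - 1) / (z + conj z - 1)) * (((κ : ℝ) : ℂ) * (((m : ℝ) : ℂ) * (φ₀ * conj φ₀)))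
          + (((T : ℝ) : ℂ) ^ (z - conj z) / (z - conj z)) * (((κ : ℝ) : ℂ) * (((m : ℝ) : ℂ) * (φ₀ * conj (c z * φ₀))))
          - (((T : ℝ) : ℂ) ^ (-(z - conj z)) / (z - conj z)) * (((κ : ℝ) : ℂ) * (((m : ℝ) : ℂ) * (c z * φ₀ * conj φ₀)))
          - (((T : ℝ) : ℂ) ^ (-(z + conj z - 1)) / (z + conj z - 1)) * (((κ : ℝ) : ℂ) * (((m : ℝ) : ℂ) * (c z * φ₀ * conj (c z * φ₀))))))‖ ≤ C :=
  exists_normSq_mul_norm_fourTerm_diag_le Cμ CK κ m hT φ₀ (ρ₀ := 1) (by simp) (by simp) hd hdc (by simpa only [one_re] using hreal)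

/-- **(MS-P) at real points for `U(1,1)`**: the `ρ₀ = 1` instance of `exists_norm_fourTerm_diag_le` (`½ < Re z₀`). [cite: MoeglinWaldspurger1995, IV.2.3, IV.3.12 (a)] -/
theorem exists_norm_fourTerm_diag_le_one (Cμ CK κ m : ℝ) {T : ℝ} (hT : 0 < T) (φ₀ : ℂ) {c : ℂ → ℂ} {z₀ : ℂ} (hz₀ : 1 / 2 < z₀.re)
    (hc : AnalyticAt ℂ c z₀) (hreal : z₀.im = 0 → ∀ᶠ x : ℝ in 𝓝[≠] z₀.re, (c (x : ℂ)).im = 0) :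
    ∃ C : ℝ, ∀ᶠ z in 𝓝 z₀, z.im ≠ 0 →
      ‖((Cμ : ℝ) : ℂ) * (((CK : ℝ) : ℂ) *
        ((((T : ℝ) : ℂ) ^ (z + conj z - 1) / (z + conj z - 1)) * (((κ : ℝ) : ℂ) * (((m : ℝ) : ℂ) * (φ₀ * conj φ₀)))
          + (((T : ℝ) : ℂ) ^ (z - conj z) / (z - conj z)) * (((κ : ℝ) : ℂ) * (((m : ℝ) : ℂ) * (φ₀ * conj (c z * φ₀))))
          - (((T : ℝ) : ℂ) ^ (-(z - conj z)) / (z - conj z)) * (((κ : ℝ) : ℂ) * (((m : ℝ) : ℂ) * (c z * φ₀ * conj φ₀)))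
          - (((T : ℝ) : ℂ) ^ (-(z + conj z - 1)) / (z + conj z - 1)) * (((κ : ℝ) : ℂ) * (((m : ℝ) : ℂ) * (c z * φ₀ * conj (c z * φ₀))))))‖ ≤ C :=
  exists_norm_fourTerm_diag_le Cμ CK κ m hT φ₀ (ρ₀ := 1) (by rw [one_re]; linarith) hc hreal

end Summit.HodgeConjecture.HodgeConjecture.Cruxes.H413.K2E1MaassSelbergDiagonalRealAxis

end
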